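import Summits.QuantumFields.BalabanUV.InfraRed.StrongCouplingReflection

/-!
# Strong-coupling front, J-SC15 (part 2/3): the TRANSVERSE second moment of a one-link law of `SU(2)` is at
most `1/4` at EVERY tilt —
observatory of the non-perturbative crossover; no mass-gap claim

IR-3 v2 TWO-FRONT CROSSOVER LEDGER, front SC (`β₀`), SU(2), `d = 4`, Wilson normalisation `β_W = 4/g²`.
observatory of the non-perturbative crossover; no mass-gap claim.

ABSOLUTE RULE. No internally-minted statement may enter as a cited fact. Every hypothesis is either
kernel-proved in this package or a verbatim quotation of a PUBLISHED theorem with page reference. The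
manuscript(s) under audit are NOT citable for their own disputed steps — they are the thing under
adjudication; programme-internal (2001/route/tribunal) claims are never citable.  THIS FILE HAS NO
HYPOTHESES: every statement below is kernel-proved from Mathlib and the tree; nothing is cited (labels [folklore]).

WHAT THIS FILE PROVES (vMF units: `x = su2Quat g ∈ S³`, `σ` = Haar, tilt `e^{κ x₀}`):
* `quarter_integral_exp_le`: `¼ ∫ e^{κx₀} dσ ≤ ∫ x₀² e^{κx₀} dσ` for EVERY real `κ` — by the pointwise sign identity
  `(x₀² − ¼)(cosh κx₀ − cosh κ/2) ≥ 0`, oddness of `(x₀² − ¼) sinh κx₀` under `g ↦ −g`, and `∫ x₀² dσ = ¼`.  (R20's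
  `quarter_integral_exp_le_six_fifths` had this for `0 ≤ κ ≤ 6/5` only, by Taylor bounds; the longitudinal CENTRED
  moment still needs `κ ≤ 6/5` — not used here.)
* `integral_sq_mul_exp_le_quarter`: for pure-imaginary `m` and every `κ`, `∫ ⟨x,m⟩² e^{κx₀} dσ ≤ (|m|²/4) ∫ e^{κx₀} dσ`
  (cross moments vanish under conjugation by `i, j, k`; the three transverse moments agree under conjugation by `ω`
  and sum to `∫ (1 − x₀²) e^{κx₀}`).
* `integral_sq_tilted_le_quarter`: for EVERY `B ∈ M₂(ℂ)` and every unit quaternion `u` with `Re(u · qp B) = 0`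
  (i.e. `u ⊥` the tilt axis `conj(qp B)` of `ν_B = σ.tilted (2 Re tr(· B))`): `∫ ⟨x,u⟩² dν_B ≤ 1/4` — axis reduction by
  a right translation (Creutz (18.17), as in R20) and the two lemmas above.  No smallness of `B`.
* `sqrt_two_mul_norm_qp_le`: `√2 |qp Δ| ≤ ‖Δ‖_F`.
Together with part 1's `cov_le_of_reflect` this gives part 3's transverse covariance bound with the constant of the
floor EXACTLY (`K₂ = 1/4`); the exact transverse value is `(1 − E_κ x₀²)/3 = 1/4 − κ²/96 + O(κ⁴)` (FRONT-SC §3k, LEMMA 2).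

NOT CLAIMED: anything about oblique or longitudinal directions at `B ≠ 0`; no mass-gap claim.
-/

noncomputable section

open MeasureTheory Filter Topology ProbabilityTheory Finset Real
open scoped NNReal Quaternion
open Literature.Probability.LatticeModels
open Literature.MathematicalPhysics.QuantumLattice (fundamentalRep fundamentalLatticeRep quatMatrix su2Quat quatToSU2)
open Literature.MathematicalPhysics.QuantumFieldTheory
open Literature.MathematicalPhysics.QuantumFieldTheory.Balaban1983to89
open Literature.MathematicalPhysics.QuantumFieldTheory.Balaban1983to89.StrongCouplingDobrushinWindow
open Literature.MathematicalPhysics.QuantumFieldTheory.Balaban1983to89.StrongCouplingTorusWindow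
open Literature.MathematicalPhysics.QuantumFieldTheory.Balaban1983to89.StrongCouplingKernelWindow
open Literature.MathematicalPhysics.QuantumFieldTheory.Balaban1983to89.StrongCouplingOpenWindow
open Literature.MathematicalPhysics.QuantumFieldTheory.Balaban1983to89.StrongCouplingVarianceWindow
open Summit.QuantumFields.BalabanUV.InfraRed.StrongCouplingSixFifthsVariance
open Summit.QuantumFields.BalabanUV.InfraRed.StrongCouplingReflection

namespace Summit.QuantumFields.BalabanUV.InfraRed.StrongCouplingTransverseMoment

local notation "SU2" => Matrix.specialUnitaryGroup (Fin 2) ℂ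
local notation "M₂" => Matrix (Fin 2) (Fin 2) ℂ
local notation "σ₂" => haarProbability (Matrix.specialUnitaryGroup (Fin 2) ℂ)

/-! ## Part D: the transverse second moment is at most `1/4` at every tilt -/

/-- **The all-`κ` floor for the longitudinal second moment**: `¼ ∫ e^{κ x₀} dσ ≤ ∫ x₀² e^{κ x₀} dσ` for EVERY real `κ`.
The odd part `(x₀² − ¼) sinh(κ x₀)` integrates to zero (`x ↦ −x`), and the even part dominates
`(x₀² − ¼) cosh(κ/2)`, whose integral vanishes (`∫ x₀² dσ = ¼`), by the pointwise sign identity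
`(x₀² − ¼)(cosh κx₀ − cosh κ/2) ≥ 0`.  (R20/J-SC10 proved this only for `0 ≤ κ ≤ 6/5`, by Taylor bounds.) [folklore] -/
theorem quarter_integral_exp_le (κ : ℝ) :
    1 / 4 * ∫ s, exp (κ * (su2Quat s).re) ∂σ₂ ≤ ∫ s, (su2Quat s).re ^ 2 * exp (κ * (su2Quat s).re) ∂σ₂ := by
  have hexpc : Continuous fun x : ℍ => exp (κ * x.re) := continuous_exp.comp (continuous_const.mul Quaternion.continuous_re)
  have hcoshc : Continuous fun x : ℍ => Real.cosh (κ * x.re) :=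
    Real.continuous_cosh.comp (continuous_const.mul Quaternion.continuous_re)
  have hsinhc : Continuous fun x : ℍ => Real.sinh (κ * x.re) :=
    Real.continuous_sinh.comp (continuous_const.mul Quaternion.continuous_re)
  have hq : Continuous fun x : ℍ => x.re ^ 2 - 1 / 4 := (Quaternion.continuous_re.pow 2).sub continuous_const
  have iZ : Integrable (fun s : SU2 => exp (κ * (su2Quat s).re)) σ₂ := integrable_comp_su2Quat (Φ := fun x => exp (κ * x.re)) hexpc
  have iU : Integrable (fun s : SU2 => (su2Quat s).re ^ 2 * exp (κ * (su2Quat s).re)) σ₂ :=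
    integrable_comp_su2Quat (Φ := fun x => x.re ^ 2 * exp (κ * x.re)) ((Quaternion.continuous_re.pow 2).mul hexpc)
  have iC : Integrable (fun s : SU2 => ((su2Quat s).re ^ 2 - 1 / 4) * Real.cosh (κ * (su2Quat s).re)) σ₂ :=
    integrable_comp_su2Quat (Φ := fun x => (x.re ^ 2 - 1 / 4) * Real.cosh (κ * x.re)) (hq.mul hcoshc)
  have iS : Integrable (fun s : SU2 => ((su2Quat s).re ^ 2 - 1 / 4) * Real.sinh (κ * (su2Quat s).re)) σ₂ :=
    integrable_comp_su2Quat (Φ := fun x => (x.re ^ 2 - 1 / 4) * Real.sinh (κ * x.re)) (hq.mul hsinhc)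
  have iK : Integrable (fun s : SU2 => ((su2Quat s).re ^ 2 - 1 / 4) * Real.cosh (κ / 2)) σ₂ :=
    integrable_comp_su2Quat (Φ := fun x => (x.re ^ 2 - 1 / 4) * Real.cosh (κ / 2)) (hq.mul continuous_const)
  -- the odd part vanishes
  have hodd : ∫ s, ((su2Quat s).re ^ 2 - 1 / 4) * Real.sinh (κ * (su2Quat s).re) ∂σ₂ = 0 := by
    refine integral_eq_zero_of_odd fun g => ?_
    have h : (su2Quat (elN * g)).re = -(su2Quat g).re := by
      show (((elN * g : SU2) : M₂) 0 0).re = -(((g : M₂) 0 0).re)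
      rw [coe_elN_mul, Matrix.neg_apply, Complex.neg_re]
    rw [h, mul_neg, Real.sinh_neg, neg_sq]
    ring
  -- the constant part vanishes: `∫ x₀² dσ = 1/4`
  have hconst : ∫ s, ((su2Quat s).re ^ 2 - 1 / 4) * Real.cosh (κ / 2) ∂σ₂ = 0 := by
    rw [integral_mul_const, integral_sub (integrable_comp_su2Quat (Φ := fun x => x.re ^ 2) (Quaternion.continuous_re.pow 2))
      (integrable_const _), integral_re_sq, integral_const]
    simp
  -- the pointwise sign identity
  have hpt : ∀ s : SU2, ((su2Quat s).re ^ 2 - 1 / 4) * Real.cosh (κ / 2) ≤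
      ((su2Quat s).re ^ 2 - 1 / 4) * Real.cosh (κ * (su2Quat s).re) := fun s => by
    by_cases h : 1 / 4 ≤ (su2Quat s).re ^ 2
    · refine mul_le_mul_of_nonneg_left (Real.cosh_le_cosh.2 ?_) (sub_nonneg.2 h)
      rw [abs_mul]
      have h1 : 1 / 2 ≤ |(su2Quat s).re| := by
        rw [← sq_abs] at h; nlinarith [abs_nonneg (su2Quat s).re]
      have : |κ / 2| = |κ| * (1 / 2) := by rw [abs_div, abs_two]; ring
      rw [this]; exact mul_le_mul_of_nonneg_left h1 (abs_nonneg κ)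
    · rw [not_le] at h
      refine mul_le_mul_of_nonpos_left (Real.cosh_le_cosh.2 ?_) (sub_nonpos.2 h.le)
      rw [abs_mul]
      have h1 : |(su2Quat s).re| ≤ 1 / 2 := by
        rw [← sq_abs] at h; nlinarith [abs_nonneg (su2Quat s).re]
      have : |κ / 2| = |κ| * (1 / 2) := by rw [abs_div, abs_two]; ring
      rw [this]; exact mul_le_mul_of_nonneg_left h1 (abs_nonneg κ)
  have heven : 0 ≤ ∫ s, ((su2Quat s).re ^ 2 - 1 / 4) * Real.cosh (κ * (su2Quat s).re) ∂σ₂ := by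
    have h := integral_mono iK iC hpt
    linarith [hconst]
  -- assemble: `∫ (x₀² − 1/4) e^{κx₀} = even + odd ≥ 0`
  have hsplit : ∫ s, (su2Quat s).re ^ 2 * exp (κ * (su2Quat s).re) ∂σ₂ - 1 / 4 * ∫ s, exp (κ * (su2Quat s).re) ∂σ₂ =
      ∫ s, ((su2Quat s).re ^ 2 - 1 / 4) * Real.cosh (κ * (su2Quat s).re) ∂σ₂ +
        ∫ s, ((su2Quat s).re ^ 2 - 1 / 4) * Real.sinh (κ * (su2Quat s).re) ∂σ₂ := by
    rw [← integral_add iC iS, ← integral_const_mul, ← integral_sub iU (iZ.const_mul _)]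
    refine integral_congr_ae (ae_of_all _ fun s => ?_)
    simp only
    rw [← Real.cosh_add_sinh (κ * (su2Quat s).re)]
    ring
  linarith [hsplit, heven, hodd]

/-- **Transverse isotropy at every tilt**: for a pure-imaginary quaternion `m` (a direction orthogonal to the tilt axis
`1`) and every real `κ`, `∫ ⟨x, m⟩'² e^{κ x₀} dσ ≤ (|m|²/4) ∫ e^{κ x₀} dσ` with `⟨x, m⟩' = Re(x m̄)`: the cross moments vanish
(conjugation by `i, j, k`), the three transverse second moments agree (conjugation by `ω`), sum to `∫ (1 − x₀²) e^{κx₀}`,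
and `∫ x₀² e^{κ x₀} ≥ ¼ ∫ e^{κ x₀}` (all `κ`). [folklore] -/
theorem integral_sq_mul_exp_le_quarter (κ : ℝ) {m : ℍ} (hm : m.re = 0) :
    ∫ g, (su2Quat g * star m).re ^ 2 * exp (κ * (su2Quat g).re) ∂σ₂ ≤
      Quaternion.normSq m / 4 * ∫ g, exp (κ * (su2Quat g).re) ∂σ₂ := by
  have hexpc : Continuous fun x : ℍ => exp (κ * x.re) := continuous_exp.comp (continuous_const.mul Quaternion.continuous_re)
  set ℓ : ℍ → ℝ := fun x => (x * star m).re ^ 2 * exp (κ * x.re) with hℓ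
  have hℓc : Continuous ℓ := ((Quaternion.continuous_re.comp (continuous_id.mul continuous_const)).pow 2).mul hexpc
  have hconjc : ∀ p q : ℍ, Continuous fun x : ℍ => p * x * q := fun p q =>
    (continuous_const.mul continuous_id).mul continuous_const
  -- the symmetrised integrand: cross terms cancel, and `m₀ = 0`
  have hsym : ∀ x : ℍ, ℓ x + ℓ (qI * x * star qI) + ℓ (qJ * x * star qJ) + ℓ (qK * x * star qK) =
      4 * (m.imI ^ 2 * (x.imI ^ 2 * exp (κ * x.re))) + 4 * (m.imJ ^ 2 * (x.imJ ^ 2 * exp (κ * x.re))) +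
        4 * (m.imK ^ 2 * (x.imK ^ 2 * exp (κ * x.re))) := by
    intro x
    simp only [hℓ, conj_qI, conj_qJ, conj_qK, re_mul_star, hm]
    ring
  have norm_qI : ‖qI‖ = 1 := norm_eq_one_of_sq_sum (by simp [qI])
  have norm_qJ : ‖qJ‖ = 1 := norm_eq_one_of_sq_sum (by simp [qJ])
  have norm_qK : ‖qK‖ = 1 := norm_eq_one_of_sq_sum (by simp [qK])
  have norm_qW : ‖qW‖ = 1 := norm_eq_one_of_sq_sum (by simp [qW]; norm_num)
  have hstI : ‖star qI‖ = 1 := by rw [norm_star]; exact norm_qI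
  have hstJ : ‖star qJ‖ = 1 := by rw [norm_star]; exact norm_qJ
  have hstK : ‖star qK‖ = 1 := by rw [norm_star]; exact norm_qK
  have hstW : ‖star qW‖ = 1 := by rw [norm_star]; exact norm_qW
  have hI := integral_comp_units ℓ norm_qI hstI
  have hJ := integral_comp_units ℓ norm_qJ hstJ
  have hK := integral_comp_units ℓ norm_qK hstK
  have iℓ : Integrable (fun g : SU2 => ℓ (su2Quat g)) σ₂ := integrable_comp_su2Quat hℓc
  have iℓI : Integrable (fun g : SU2 => ℓ (qI * su2Quat g * star qI)) σ₂ :=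
    integrable_comp_su2Quat (Φ := fun x => ℓ (qI * x * star qI)) (hℓc.comp (hconjc _ _))
  have iℓJ : Integrable (fun g : SU2 => ℓ (qJ * su2Quat g * star qJ)) σ₂ :=
    integrable_comp_su2Quat (Φ := fun x => ℓ (qJ * x * star qJ)) (hℓc.comp (hconjc _ _))
  have iℓK : Integrable (fun g : SU2 => ℓ (qK * su2Quat g * star qK)) σ₂ :=
    integrable_comp_su2Quat (Φ := fun x => ℓ (qK * x * star qK)) (hℓc.comp (hconjc _ _))
  have iV1 : Integrable (fun g : SU2 => (su2Quat g).imI ^ 2 * exp (κ * (su2Quat g).re)) σ₂ :=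
    integrable_comp_su2Quat (Φ := fun x => x.imI ^ 2 * exp (κ * x.re)) ((Quaternion.continuous_imI.pow 2).mul hexpc)
  have iV2 : Integrable (fun g : SU2 => (su2Quat g).imJ ^ 2 * exp (κ * (su2Quat g).re)) σ₂ :=
    integrable_comp_su2Quat (Φ := fun x => x.imJ ^ 2 * exp (κ * x.re)) ((Quaternion.continuous_imJ.pow 2).mul hexpc)
  have iV3 : Integrable (fun g : SU2 => (su2Quat g).imK ^ 2 * exp (κ * (su2Quat g).re)) σ₂ :=
    integrable_comp_su2Quat (Φ := fun x => x.imK ^ 2 * exp (κ * x.re)) ((Quaternion.continuous_imK.pow 2).mul hexpc)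
  have iU : Integrable (fun g : SU2 => (su2Quat g).re ^ 2 * exp (κ * (su2Quat g).re)) σ₂ :=
    integrable_comp_su2Quat (Φ := fun x => x.re ^ 2 * exp (κ * x.re)) ((Quaternion.continuous_re.pow 2).mul hexpc)
  set Z : ℝ := ∫ g, exp (κ * (su2Quat g).re) ∂σ₂ with hZ
  set U : ℝ := ∫ g, (su2Quat g).re ^ 2 * exp (κ * (su2Quat g).re) ∂σ₂ with hU
  set V1 : ℝ := ∫ g, (su2Quat g).imI ^ 2 * exp (κ * (su2Quat g).re) ∂σ₂ with hV1
  set V2 : ℝ := ∫ g, (su2Quat g).imJ ^ 2 * exp (κ * (su2Quat g).re) ∂σ₂ with hV2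
  set V3 : ℝ := ∫ g, (su2Quat g).imK ^ 2 * exp (κ * (su2Quat g).re) ∂σ₂ with hV3
  -- `4 ∫ ℓ = 4 (m₁² V1 + m₂² V2 + m₃² V3)`
  have h4 : 4 * ∫ g, ℓ (su2Quat g) ∂σ₂ = 4 * (m.imI ^ 2 * V1) + 4 * (m.imJ ^ 2 * V2) + 4 * (m.imK ^ 2 * V3) := by
    have j1 : Integrable (fun g : SU2 => ℓ (su2Quat g) + ℓ (qI * su2Quat g * star qI)) σ₂ := iℓ.add iℓI
    have j2 : Integrable (fun g : SU2 => ℓ (su2Quat g) + ℓ (qI * su2Quat g * star qI) + ℓ (qJ * su2Quat g * star qJ)) σ₂ :=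
      j1.add iℓJ
    have hs : ∫ g, (ℓ (su2Quat g) + ℓ (qI * su2Quat g * star qI) + ℓ (qJ * su2Quat g * star qJ) +
        ℓ (qK * su2Quat g * star qK)) ∂σ₂ = 4 * ∫ g, ℓ (su2Quat g) ∂σ₂ := by
      rw [integral_add j2 iℓK, integral_add j1 iℓJ, integral_add iℓ iℓI, hI, hJ, hK]
      ring
    rw [← hs]
    simp_rw [hsym]
    have k2 : Integrable (fun g : SU2 => 4 * (m.imI ^ 2 * ((su2Quat g).imI ^ 2 * exp (κ * (su2Quat g).re)))) σ₂ :=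
      (iV1.const_mul _).const_mul _
    have k3 : Integrable (fun g : SU2 => 4 * (m.imJ ^ 2 * ((su2Quat g).imJ ^ 2 * exp (κ * (su2Quat g).re)))) σ₂ :=
      (iV2.const_mul _).const_mul _
    have k4 : Integrable (fun g : SU2 => 4 * (m.imK ^ 2 * ((su2Quat g).imK ^ 2 * exp (κ * (su2Quat g).re)))) σ₂ :=
      (iV3.const_mul _).const_mul _
    have l1 : Integrable (fun g : SU2 => 4 * (m.imI ^ 2 * ((su2Quat g).imI ^ 2 * exp (κ * (su2Quat g).re))) +
        4 * (m.imJ ^ 2 * ((su2Quat g).imJ ^ 2 * exp (κ * (su2Quat g).re)))) σ₂ := k2.add k3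
    rw [integral_add l1 k4, integral_add k2 k3, integral_const_mul, integral_const_mul, integral_const_mul,
      integral_const_mul, integral_const_mul, integral_const_mul]
  -- isotropy: `V2 = V1`, `V3 = V1`
  have eV2 : V1 = V2 := by
    have h := integral_comp_units (fun x : ℍ => x.imJ ^ 2 * exp (κ * x.re)) norm_qW hstW
    simp only [conj_qW] at h
    exact h
  have eV3 : V3 = V1 := by
    have h := integral_comp_units (fun x : ℍ => x.imI ^ 2 * exp (κ * x.re)) norm_qW hstW
    simp only [conj_qW] at h
    exact h
  -- the sphere: `U + V1 + V2 + V3 = Z`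
  have hsphere : U + V1 + V2 + V3 = Z := by
    have m1 : Integrable (fun g : SU2 => (su2Quat g).re ^ 2 * exp (κ * (su2Quat g).re) +
        (su2Quat g).imI ^ 2 * exp (κ * (su2Quat g).re)) σ₂ := iU.add iV1
    have m2 : Integrable (fun g : SU2 => (su2Quat g).re ^ 2 * exp (κ * (su2Quat g).re) +
        (su2Quat g).imI ^ 2 * exp (κ * (su2Quat g).re) + (su2Quat g).imJ ^ 2 * exp (κ * (su2Quat g).re)) σ₂ := m1.add iV2
    rw [hU, hV1, hV2, hV3, hZ, ← integral_add iU iV1, ← integral_add m1 iV2, ← integral_add m2 iV3]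
    refine integral_congr_ae (ae_of_all _ fun g => ?_)
    have h1 := sq_sum_su2Quat g
    simp only
    linear_combination exp (κ * (su2Quat g).re) * h1
  -- the all-`κ` longitudinal floor
  have hUge : 1 / 4 * Z ≤ U := quarter_integral_exp_le κ
  have hZ0 : 0 ≤ Z := integral_nonneg fun g => (exp_pos _).le
  have hV1le : V1 ≤ Z / 4 := by linarith
  have hnormSq : Quaternion.normSq m = m.re ^ 2 + m.imI ^ 2 + m.imJ ^ 2 + m.imK ^ 2 := Quaternion.normSq_def' m
  show ∫ g, ℓ (su2Quat g) ∂σ₂ ≤ Quaternion.normSq m / 4 * Z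
  rw [hnormSq, hm]
  nlinarith [sq_nonneg m.imI, sq_nonneg m.imJ, sq_nonneg m.imK, eV2, eV3]

/-- `√2 · |qp Δ| ≤ ‖Δ‖_F` (the quaternionic part is an orthogonal projection of `M₂(ℂ) ≅ ℝ⁸`, up to the factor `√2`).
[folklore] -/
theorem sqrt_two_mul_norm_qp_le (Δ : M₂) : Real.sqrt 2 * ‖qp Δ‖ ≤ frobNorm Δ := by
  have h := coef_sq_le Δ
  have e : ((Δ 0 0).re + (Δ 1 1).re) ^ 2 + ((Δ 1 1).im - (Δ 0 0).im) ^ 2 + ((Δ 1 0).re - (Δ 0 1).re) ^ 2 +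
      ((Δ 1 0).im + (Δ 0 1).im) ^ 2 = 4 * Quaternion.normSq (qp Δ) := by
    rw [Quaternion.normSq_def']; simp only [qp]; ring
  have hn : Quaternion.normSq (qp Δ) = ‖qp Δ‖ ^ 2 := by rw [Quaternion.normSq_eq_norm_mul_self, sq]
  have h2 : (Real.sqrt 2 * ‖qp Δ‖) ^ 2 ≤ frobNorm Δ ^ 2 := by
    rw [mul_pow, Real.sq_sqrt (by norm_num : (0:ℝ) ≤ 2), ← hn]; linarith
  exact (sq_le_sq₀ (by positivity) (frobNorm_nonneg Δ)).1 h2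

/-- **The transverse second moment of the one-link law is at most `1/4`, for EVERY `B`.**  If the unit quaternion `u`
is orthogonal to the tilt axis of `ν_B = σ.tilted (2 Re tr(· B))` (`Re(u · qp B) = 0`), then `∫ ⟨x, u⟩² dν_B ≤ 1/4`
— no smallness of `B` is needed.  Axis reduction by a right translation (Creutz (18.17)) and the isotropy lemma. [folklore] -/
theorem integral_sq_tilted_le_quarter (B : M₂) {u : ℍ} (hu : ‖u‖ = 1) (hub : (u * qp B).re = 0) :
    ∫ s, (su2Quat s * star u).re ^ 2 ∂((σ₂).tilted (pot B)) ≤ 1 / 4 := by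
  have hnu : Quaternion.normSq u = 1 := by rw [Quaternion.normSq_eq_norm_mul_self, hu, mul_one]
  -- the tilted integral as a ratio of Haar integrals
  have hexpF : Integrable (fun s => exp (pot B s)) σ₂ := integrable_exp_pot B
  set Z : ℝ := ∫ s, exp (pot B s) ∂σ₂ with hZ
  have hZpos : 0 < Z := by rw [hZ]; exact integral_exp_pos hexpF
  have h1 : ∫ s, (su2Quat s * star u).re ^ 2 ∂((σ₂).tilted (pot B)) =
      (∫ s, exp (pot B s) * (su2Quat s * star u).re ^ 2 ∂σ₂) / Z := by
    rw [integral_tilted]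
    simp_rw [smul_eq_mul, div_mul_eq_mul_div]
    exact integral_div _ _
  rw [h1, div_le_iff₀ hZpos]
  by_cases hb : qp B = 0
  · -- no tilt: `ν_B = σ`, and `∫ ⟨x, u⟩² dσ = 1/4` (rotate `u` to `1`)
    have hp : ∀ s, pot B s = 0 := fun s => by rw [pot_eq, hb, mul_zero, Quaternion.re_zero, mul_zero]
    simp only [hp, exp_zero, one_mul] at hZ ⊢
    have hZ1 : Z = 1 := by rw [hZ, integral_const, smul_eq_mul, mul_one]; simp
    rw [hZ1, mul_one]
    have h := integral_sq_sub_mul_exp_le_six_fifths le_rfl (by norm_num) (star u)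
    simp only [mul_zero, zero_div, sub_zero, zero_mul, exp_zero, mul_one, integral_const, smul_eq_mul,
      Quaternion.normSq_star, hnu] at h
    simpa using h
  · -- axis reduction by the right translation `x ↦ x · y`, `y = |b|⁻¹ b̄`
    have hn : ‖qp B‖ ≠ 0 := norm_ne_zero_iff.2 hb
    set y : ℍ := ‖qp B‖⁻¹ • star (qp B) with hy
    have hy1 : ‖y‖ = 1 := by rw [hy, norm_smul, norm_inv, norm_norm, norm_star, inv_mul_cancel₀ hn]
    have hyb : y * qp B = ((‖qp B‖ : ℝ) : ℍ) := by
      rw [hy, smul_mul_assoc, Quaternion.star_mul_self, Quaternion.normSq_eq_norm_mul_self, Quaternion.coe_mul,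
        ← Quaternion.coe_mul_eq_smul, ← mul_assoc, ← Quaternion.coe_mul, inv_mul_cancel₀ hn, Quaternion.coe_one,
        one_mul]
    set m' : ℍ := u * star y with hm'
    have hm'0 : m'.re = 0 := by
      have e : m'.re = ‖qp B‖⁻¹ * (u * qp B).re := by
        rw [hm', re_mul_star, hy, Quaternion.re_mul]
        simp only [Quaternion.re_smul, Quaternion.imI_smul, Quaternion.imJ_smul, Quaternion.imK_smul,
          Quaternion.re_star, Quaternion.imI_star, Quaternion.imJ_star, Quaternion.imK_star, smul_eq_mul]
        ring
      rw [e, hub, mul_zero]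
    have hnm' : Quaternion.normSq m' = 1 := by
      rw [hm', map_mul, Quaternion.normSq_star, hnu, Quaternion.normSq_eq_norm_mul_self, hy1]
      norm_num
    set κ : ℝ := 4 * ‖qp B‖ with hκ
    have hre : ∀ x : ℍ, (x * y * qp B).re = x.re * ‖qp B‖ := fun x => by
      rw [mul_assoc, hyb, Quaternion.re_mul]
      simp
    have hexp : ∀ x : ℍ, exp (4 * (x.re * ‖qp B‖)) = exp (κ * x.re) := fun x => by rw [hκ]; ring_nf
    have htr : ∀ x : ℍ, (x * y * star u).re = (x * star m').re := fun x => by rw [hm', star_mul, star_star, mul_assoc]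
    have h3 : ∫ s, exp (pot B s) * (su2Quat s * star u).re ^ 2 ∂σ₂ =
        ∫ g, (su2Quat g * star m').re ^ 2 * exp (κ * (su2Quat g).re) ∂σ₂ := by
      have h := integral_comp_unit_right (fun x : ℍ => exp (4 * (x * qp B).re) * (x * star u).re ^ 2) hy1
      simp only [hre, hexp, htr] at h
      simp only [pot_eq]
      rw [← h]
      refine integral_congr_ae (ae_of_all _ fun g => ?_)
      simp only
      ring
    have hZ' : Z = ∫ g, exp (κ * (su2Quat g).re) ∂σ₂ := by
      have h := integral_comp_unit_right (fun x : ℍ => exp (4 * (x * qp B).re)) hy1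
      simp only [hre, hexp] at h
      rw [hZ]
      simp only [pot_eq]
      exact h.symm
    have h4 := integral_sq_mul_exp_le_quarter κ hm'0
    rw [hnm', ← hZ'] at h4
    rw [h3]
    linarith


end Summit.QuantumFields.BalabanUV.InfraRed.StrongCouplingTransverseMoment
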